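import Summits.HodgeConjecture.HodgeConjecture.Theorems.F0P6aSerreTensorFibreMarkedAtSiegelPoint   -- ★ p850866 (LA4-p03 (g3)) DEAL #42 §1 `exists_markedSerreTensorFibre` (+ σ1-UNPACK ★ p850665, ★ Theorems twins of the E-defs)
import Literature.AlgebraicGeometry.ShimuraVarieties.UnitaryCurveAuxiliaryTorusLegLift                 -- ★ p850805 (LA5-p02 (g4)) DEAL #41 `exists_isLambdaOfAt_symplecticLift_torusLeg` (the tower of the twisted marked fibre)
import Literature.AlgebraicGeometry.ModuliOfAbelianVarieties.SiegelAdmissibleOfBaseChangePackage       -- ★ p850842 (LA4-p02 (g2)) DEAL #38 `isAdmissibleAt_baseChange_of_admPackage` + ★ p850754∕771∕827 `pts_comp_classifyingMap_eq_mk_of_isAdmissibleAt`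
import Literature.AlgebraicGeometry.AbelianSchemes.SerreTwistPolarization                             -- ★ `IsExactTwistPol`, `isExactTwistPol_iff` ((t3) of the twist)
import Literature.AlgebraicGeometry.ShimuraVarieties.UnitaryShimuraCurveRecordMorphisms               -- ★ `RecordSystemGS.HeckeTranslateDefinedOver` (the letter՚s `hU7ₛ` binder)
import Literature.NumberTheory.NumberFields.IdealClassCoprimeRepresentative                           -- ★ `pointwise_smul_ne_bot` (`n ≠ 0` from rows (a)(c))
import HarnessLib

/-!
# ORGAN (B2) = DEAL #38 «`hε₂` — THE CLASSIFYING SLICE OF THE TWISTED TUPLE READS THE TWISTED POINT MAP» — PAID (★ twin of the socket of LA7-p01 (g4)՚s LEG-E(γ′) frame)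

Cell `hodgecm-mathlib` (D-0151), FLOOR 0, P6 «MOD programme», crux hLiu418 (stmt-HodgeConjecture-24832, `--supports`, count-neutral), line «L4», (S8) sheet-line
closer `Cruxes/HLiu418/Lines/F0_P6a_StubESHEET.lean`, socket `hole_SHEET_global : OrganSHEETGlobal` (ED. 2), LEG-E(γ′) GLOBAL GLUE (LA7-p01 (g4) frame v2
`F0/P6/L7/LA7-p01/g4/OrganSHEETGlobalPay.frame.v2.LA7-p01g4.lean` sha16 0296e4019f2e16e6) organ **(B2)** — LA4-plan (g2) DEAL #45 (2026-09-02T10:10Z) → LA4-p02 (g2).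
THIS FILE PROVES THE SOCKET `OrganB2` OF THE FRAME, BODY VERBATIM (frame v2 :318–:370), in ★ Theorems currency (the re-homed twins `Theorems.F0P6aPELWitnessEDefs` ∕
`F0P6aStubE6Sockets` ∕ `F0P6aChartFramePin`, same FQNs as the `Lines/` originals), so that the glue՚s head `organSHEETGlobal_of_organs : (B1) → (B2) → (B3) → OrganSHEETGlobal`
is fed `organB2_holds` BY NAME.  HONEST LABEL: HC_CM is proved only modulo the 7 printed citations (2 remaining: hLiu418 = stmt-HodgeConjecture-24832,
h413 = stmt-HodgeConjecture-24833) until rung 0 closes; this file is count-neutral.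

THE MATHEMATICS ([Milne2005ShimuraVarieties] Thm. 6.11 «`ℳ_K/≈ ≃ Sh_K(ℂ)`»; [Shimura1998] §18.6 «`A ⊗ 𝔞⁻¹ = ℂ^g ∕ 𝔞⁻¹Λ`, marked by the translate»; [MFK94] Ch. 7 §2 Def. 7.2–7.3).
At a `τE`-complex point `x` of `X = Sh_{Kc} ⊗_F Fᵢ` with flat shadow `[v, a]`: DEAL #42 §1 (★ p850866) marks the twisted fibre `B_x = (P.A ⊗ 𝔞⁻¹)_x` by
`[J(C.Z a v), r′·ũ_V(1, t)]` (`r′ = (q a)_𝔸⁻¹·b(a)`, class `= [C.J v, C.b a·ũ_V(1,t)]`), DEAL #41 (★ p850805) lifts the twisted level structure symplectically at `x` with the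
tower read through that marking (exact polarisation (t3) + transported level (t5) + the torus arithmetic `[t] = 𝔞⁻¹`, `t ≡ 1 mod N`, `t t̄ = q`), whence the fibre of
`T_𝔞 = (P.A ⊗ 𝔞⁻¹, λ_B, η_B)` at `x` is ADMISSIBLE at that representative (★ p850842 `isAdmissibleAt_baseChange_of_admPackage`); an admissible fibre is classified by the
Siegel point of its class at ANY representative (★ p850754∕p850771 `pts_comp_classifyingMap_eq_mk_of_isAdmissibleAt`, Milne 6.11 + ★ (U) junction), so the classifying
map `φ` of `T_𝔞` sends `x` to `pts⁻¹[C.J v, C.b a·ũ_V(1,t)]`, which is the value `f₂[v, a]` of ANY point map with that shadow; `ε₂` has first projection `φ`.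
[cite: Milne2005ShimuraVarieties, §6 Thm. 6.11 pp. 74–75; §14 pp. 124–125] [cite: Shimura1998, §18.6 Thm. 18.6 pp. 124–125] [cite: MumfordFogartyKirwan1994, Ch. 7 §2 Def. 7.2–7.3 (p. 129), §3 Thm. 7.9 (p. 139)]
-/

set_option autoImplicit false

noncomputable section

namespace Summit.HodgeConjecture.HodgeConjecture.Theorems.F0P6aOrganB2SiegelAdmissible

set_option linter.dupNamespace false  -- `Summit.HodgeConjecture.HodgeConjecture.…` BY DESIGN (D-0017)

open CategoryTheory CategoryTheory.Limits NumberField IsDedekindDomain MulAction AlgebraicGeometry Topology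
open scoped Matrix Polynomial Pointwise nonZeroDivisors MonObj
open Literature.NumberTheory.GaloisRepresentations
open Literature.NumberTheory.Automorphic Literature.NumberTheory.Automorphic.UnitaryGroup
open Literature.AlgebraicGeometry.ShimuraVarieties Literature.AlgebraicGeometry.ShimuraVarieties.UnitaryCanonicalModel
open Literature.NumberTheory.Automorphic.Liu2021.AppendixC
open Literature.AlgebraicGeometry.Motives (AlgPoints ComplexPoints SchemeOver specOver CartierDivisor CMType)
open Literature.AlgebraicGeometry.Motives.AbelianVariety (bcSpec)
open Literature.AlgebraicGeometry.AbelianSchemes (PolarizedAbelianSchemeWithLevel AbelianSchemeOver)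
open Literature.AlgebraicGeometry.ModuliOfAbelianVarieties
open Summit.HodgeConjecture.HodgeConjecture.Cruxes.HLiu418.F0P6aPELWitnessE
open Summit.HodgeConjecture.HodgeConjecture.Cruxes.HLiu418.F0P6aStubE6 (RingActionReading)
open Summit.HodgeConjecture.HodgeConjecture.Cruxes.HLiu418.F0P6aChartFramePin (IsChartOfFrame)
open Literature.AlgebraicGeometry.ShimuraVarieties.UnitaryCanonicalModel.Aux (ratBasis torusFinAdelic reflexField numberField_reflexField)
open Literature.AlgebraicGeometry.ShimuraVarieties.UnitaryCurve Literature.AlgebraicGeometry.ShimuraVarieties.UnitaryCurve.AuxV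
open Literature.NumberTheory.ComplexMultiplication (reflexNormFiniteIdele)
open Literature.NumberTheory.ComplexMultiplication.CMTypeOps (flip bar)
open Summit.HodgeConjecture.HodgeConjecture.Theorems.F0P6aSerreTensorFibreMarkedAtSiegelPoint (exists_markedSerreTensorFibre)

set_option maxHeartbeats 800000 in -- the statement re-binds the frame՚s (B2) telescope (σ1-UNPACK՚s context + the Serre presentation data + the slice), as ★ p850866∕p850896
/-- **ORGAN (B2) PAID — `organB2_holds : <body of OrganB2>`** (LA7-p01 (g4) frame v2 §2b VERBATIM): in the letter՚s chart context, for ideal data `(𝔞, n, t)` with rows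
(c)(a)(b), `[t] = 𝔞⁻¹`, `t ≡ 1 mod N`, every twisted moduli tuple `T_𝔞 = (P.A ⊗ 𝔞⁻¹, λ_B, η_B)` on a Serre presentation of `𝔞⁻¹` (exact `λ_B`, transported `η_B`), every
`Fᵢ`-slice `ε₂` whose first projection is the classifying map of `T_𝔞`, and every point map `f₂` with Siegel shadow `[C.J v, C.b a·ũ_V(1,t)]`: `ε₂` READS `f₂` on the complex
points of the `τE`-sheet.  Proof: DEAL #42 §1 ★ p850866 at the point ⊕ DEAL #41 ★ p850805 at the torus leg ⊕ DEAL #38 ★ p850842∕p850754 (admissible ⇒ classified at ANY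
representative) ⊕ σ1-UNPACK՚s class identity ⊕ `pts`∕`bce` injective. [cite: Milne2005ShimuraVarieties, §6 Thm. 6.11 pp. 74–75; §14 pp. 124–125]
[cite: Shimura1998, §18.6 Thm. 18.6 pp. 124–125] [cite: MumfordFogartyKirwan1994, Ch. 7 §2 Def. 7.2–7.3 (p. 129), §3 Thm. 7.9 (p. 139)] -/
theorem organB2_holds :
  ∀ (F : Type) [Field F] [NumberField F] [IsCMField F] [IsGalois ℚ F] (ι₁ : F →+* ℂ)
    (Jstar : Matrix (Fin 2) (Fin 2) F) (_hJ : (Jstar.map (IsCMField.complexConj F))ᵀ = Jstar) (_hJu : IsUnit Jstar)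
    (K₀ : C5.OpenCompactSubgroup (GSAdele F Jstar)) (S : RecordSystemGS F Jstar ι₁ K₀) (_hU7ₛ : S.HeckeTranslateDefinedOver) (Kc : C5.SmallLevel K₀)
    (Fi : Type) [Field Fi] [NumberField Fi] [Algebra F Fi] [IsGalois F Fi] (τE : Fi →+* ℂ) (_hτE : τE.comp (algebraMap F Fi) = ι₁)
    (Φ : Set (F →+* ℂ)) (hΦ : IsCMTypeThrough ι₁ Φ) (C : AuxChartGS F ι₁ Jstar K₀ S Kc Fi τE Φ)
    (ξ : F) (k : ℕ) (Fr : SymplecticFrameV F (RingHom.id F) Jstar ((k : ℚ) • ξ) C.g C.δ) (_hpin : IsChartOfFrame hΦ C ξ k Fr)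
    (ε : (Literature.AlgebraicGeometry.Motives.baseChange F Fi).obj (S.M.obj Kc) ⟶
        (Literature.AlgebraicGeometry.Motives.baseChange ℚ Fi).obj C.𝓜.M)
    (_hε : letI : Algebra Fi ℂ := τE.toAlgebra
      ∀ (P : ComplexPoints ((Literature.AlgebraicGeometry.Motives.baseChange F Fi).obj (S.M.obj Kc)))
        (Pflat : letI : Algebra F ℂ := ι₁.toAlgebra; ComplexPoints (S.M.obj Kc)),
        Pflat.left = P.left ≫ pullback.fst (S.M.obj Kc).hom (bcSpec F Fi) →
        (AlgPoints.map ε P).left ≫ pullback.fst C.𝓜.M.hom (bcSpec ℚ Fi) =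
          (letI : Algebra F ℂ := ι₁.toAlgebra; (C.f (S.pts Kc Pflat)).left))
    (ρ : AbelianSchemeOver.RingAction (𝓞 F) (C.𝓜.univ.baseChange (ε.left ≫ pullback.fst C.𝓜.M.hom (bcSpec ℚ Fi))).A),
    RingActionReading C ε ρ →
    ∀ (𝔞 : Ideal (𝓞 F)) (n : ℕ) (t : ↥(torusFinAdelic F)),
      𝔞 ≠ ⊥ → Ideal.span {((n : ℕ) : 𝓞 F)} = 𝔞 * (IsCMField.complexConj F) • 𝔞 → 𝔞 ⊔ Ideal.span {((C.N : ℕ) : 𝓞 F)} = ⊤ →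
      FiniteAdeleRing.toFractionalIdeal (𝓞 F) F (t : (FiniteAdeleRing (𝓞 F) F)ˣ) = ((𝔞 : FractionalIdeal (𝓞 F)⁰ F))⁻¹ →
      (∀ v : HeightOneSpectrum (𝓞 F), Ideal.span {((C.N : ℕ) : 𝓞 F)} ≤ v.asIdeal →
        Valued.v (((t : (FiniteAdeleRing (𝓞 F) F)ˣ) : FiniteAdeleRing (𝓞 F) F) v) = 1 ∧
        Valued.v (((t : (FiniteAdeleRing (𝓞 F) F)ˣ) : FiniteAdeleRing (𝓞 F) F) v - 1) ≤
          WithZero.exp (-(modulusExp (Ideal.span {((C.N : ℕ) : 𝓞 F)}) v : ℤ))) →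
      letI P := C.𝓜.univ.baseChange (ε.left ≫ pullback.fst C.𝓜.M.hom (bcSpec ℚ Fi))
      letI X := (Literature.AlgebraicGeometry.Motives.baseChange F Fi).obj (S.M.obj Kc)
  ∀ [IsCommMonObj P.A.X] [IsLocallyNoetherian (Over.mk (X.hom ≫ bcSpec ℚ Fi) : SchemeOver ℚ).left] (m : ℕ)
    (E' : Matrix (Fin m) (Fin m) (𝓞 F)) (hE' : E' * E' = E') (Pm : Matrix (Fin m) (Fin 1) (𝓞 F)) (Qm : Matrix (Fin 1) (Fin m) (𝓞 F)),
    E' * Pm = Pm → Qm * E' = Qm → Qm * Pm = Matrix.scalar (Fin 1) ((n : ℕ) : 𝓞 F) → Pm * Qm = Matrix.scalar (Fin m) ((n : ℕ) : 𝓞 F) * E' →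
    Ideal.span (Set.range fun j => Pm j 0) = 𝔞 →
    ∀ (Db : (AbelianSchemeOver.serreTensor ρ E' hE').DualPair)
      (hDb : Nonempty ((Scheme.Modules.pullback (AbelianSchemeOver.DualPair.unitHatSlice Db)).obj Db.P ≅ SheafOfModules.unit _))
      (polB : (AbelianSchemeOver.serreTensor ρ E' hE').Polarization Db)
      (lvl' : (AbelianSchemeOver.serreTensor ρ E' hE').LevelStructure C.g C.N)
      (hrel : (AbelianSchemeOver.serreTensor ρ E' hE').IsOfRelDim C.g) (hTB : polB.HasType C.δ) (hsB : lvl'.IsSymplecticLiftable polB C.δ),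
      AbelianSchemeOver.IsExactTwistPol ρ E' hE' Pm P.D Db P.pol n polB.lam →
      (∀ i, lvl'.σ i = P.level.σ i ≫ AbelianSchemeOver.serreTranslate ρ E' hE' Pm) →
      ∀ (ε₂ : X ⟶ (Literature.AlgebraicGeometry.Motives.baseChange ℚ Fi).obj C.𝓜.M),
        ε₂.left ≫ pullback.fst C.𝓜.M.hom (bcSpec ℚ Fi) =
          (C.𝓜.classifyingMap (Over.mk (X.hom ≫ bcSpec ℚ Fi) : SchemeOver ℚ)
            (⟨AbelianSchemeOver.serreTensor ρ E' hE', hrel, Db, polB, hTB, lvl', hsB, hDb⟩ :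
              PolarizedAbelianSchemeWithLevel C.g C.N C.δ X.left)).left →
        ∀ (f₂ : ShimuraSetGS F Jstar ι₁ Kc.1.1 → ComplexPoints C.𝓜.M),
          (∀ (v : Fin 2 → ℂ) (hv : v ∈ negCone (Jstar.map ι₁)) (a : GSAdele F Jstar),
            C.pts (AlgPoints.baseChangeEquiv (algebraMap ℚ ℂ) C.𝓜.M (f₂ (ShimuraSetGS.mk F Jstar ι₁ Kc.1.1 v hv a))) =
              SiegelShimuraSet.mk C.δ (principalLevelSubgroup C.δ C.N) ⟨C.J v, C.hJ v hv⟩ (C.b a * auxToGspFinV Fr (1, t))) →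
          letI : Algebra Fi ℂ := τE.toAlgebra
          ∀ (Pt : ComplexPoints X) (Pflat : letI : Algebra F ℂ := ι₁.toAlgebra; ComplexPoints (S.M.obj Kc)),
            Pflat.left = Pt.left ≫ pullback.fst (S.M.obj Kc).hom (bcSpec F Fi) →
            (AlgPoints.map ε₂ Pt).left ≫ pullback.fst C.𝓜.M.hom (bcSpec ℚ Fi) =
              (letI : Algebra F ℂ := ι₁.toAlgebra; (f₂ (S.pts Kc Pflat)).left)
    := by
  intro F _ _ _ _ ι₁ Jstar hJ hJu K₀ S hU7ₛ Kc Fi _ _ _ _ τE hτE Φ hΦ C ξ k Fr hpin ε hε ρ hρ 𝔞 n t h𝔞 hrow_a hrow_b hz hcong instComm instLN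
    m E' hE' Pm Qm hP hQ hQP hPQ hspan Db hDb polB lvl' hrel hTB hsB hex h5 ε₂ hε₂ f₂ hf₂ Pt Pflat hPflat
  letI : Algebra F ℂ := ι₁.toAlgebra
  letI : Algebra Fi ℂ := τE.toAlgebra
  let P := C.𝓜.univ.baseChange (ε.left ≫ pullback.fst C.𝓜.M.hom (bcSpec ℚ Fi))
  -- `n ≠ 0` from rows (a)(c); `N ≠ 0`
  have hn : n ≠ 0 := by
    intro hn
    have h0 : 𝔞 * (IsCMField.complexConj F) • 𝔞 ≠ ⊥ :=
      mul_ne_zero h𝔞 (Literature.NumberTheory.NumberFields.pointwise_smul_ne_bot (IsCMField.complexConj F) h𝔞)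
    apply h0
    rw [← hrow_a, hn, Nat.cast_zero, Ideal.span_singleton_eq_bot]
  have hN0 : C.N ≠ 0 := by have := C.hN; omega
  -- the multiplier of the torus idèle
  obtain ⟨q, hq⟩ := (Literature.AlgebraicGeometry.ShimuraVarieties.UnitaryCanonicalModel.Aux.mem_torusFinAdelic_iff F
    (t : (FiniteAdeleRing (𝓞 F) F)ˣ)).1 t.2
  -- DEAL #42 §1 at the point `Pt`: σ1՚s marked fibre of `P_x`, the marking `m_B` of the twisted fibre, and the class identity
  obtain ⟨v, hv, a', k', mk, Θ, Λ, mB, hpts, hk', hrepk, -, hlam, hlvl, -, -, -, -, -, -, hcls, hmB, -⟩ :=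
    exists_markedSerreTensorFibre hΦ C ξ k Fr hpin ε ρ hρ Pt Pflat hPflat 𝔞 h𝔞 t hz E' hE' Pm Qm hn hP hQ hQP hPQ hspan
  -- `Λ` is read by `m` through `k · r′⁻¹ = rep⁻¹`
  have hkr : k' * ((gspRationalToFinAdelic C.δ (C.q a'))⁻¹ * C.b a')⁻¹ = (C.rep (C.piece a'))⁻¹ := by
    rw [hrepk]; group
  have hlvl' : ∀ ⦃M : ℕ⦄, C.N ∣ M → M ≠ 0 → ∀ (y : Fin C.g ⊕ Fin C.g → ZMod M) (w' : Fin C.g ⊕ Fin C.g → ℚ),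
      AdelicCongr ((k' * ((gspRationalToFinAdelic C.δ (C.q a'))⁻¹ * C.b a')⁻¹ : ↥(gspFinAdelic C.δ)) : GL (Fin C.g ⊕ Fin C.g) finAdeleQ) 1 w'
          (fun i => ((y i).val : ℚ) / M) →
        ((Λ.lift M (Multiplicative.ofAdd y)) : (P.A.fibre Pt.left).toAbelianVariety.Points ℂ) = mk.r w' := by
    intro M hM hM0 y w' hw'
    rw [hkr] at hw'
    exact hlvl hM hM0 y w' hw'
  -- the rows of the twist at hand: (t3) = `IsExactTwistPol`, (surj) from the presentation
  haveI := AbelianSchemeOver.isMonHom_serreTranslate ρ E' hE' Pm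
  have hex' := (AbelianSchemeOver.isExactTwistPol_iff ρ E' hE' Pm P.D Db P.pol n polB.lam).1 hex
  obtain ⟨-, -, hsurj, -, -⟩ := AbelianSchemeOver.serreCover_rows_of_presentation ρ E' hE' Pm Qm hn hP hQ hQP hPQ hspan
  haveI : Surjective (AbelianSchemeOver.serreTranslate ρ E' hE' Pm).left := ⟨hsurj⟩
  -- DEAL #41 at the torus leg: the (ADM)-package of the twisted fibre at `Pt`, in FIBRE currency, read through `m_B`
  obtain ⟨Θ₂, hample₂, hΘ₂, Λ₂, htower₂⟩ := exists_isLambdaOfAt_symplecticLift_torusLeg C.hδ C.hg Fr C.ρ₀ hpin.2.2.2 t 𝔞 h𝔞 hz hn hrow_a hN0 hcong q hq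
    (AbelianSchemeOver.serreTranslate ρ E' hE' Pm) P.level lvl' h5 P.pol polB hex' hk' Θ hlam Λ mk hlvl' mB hmB
  -- the twisted tuple over `X` read over `ℚ`, and the point `Pt` as a `ℚ`-point of it
  let X := (Literature.AlgebraicGeometry.Motives.baseChange F Fi).obj (S.M.obj Kc)
  let Xℚ : SchemeOver ℚ := Over.mk (X.hom ≫ bcSpec ℚ Fi)
  let T𝔞 : PolarizedAbelianSchemeWithLevel C.g C.N C.δ X.left :=
    ⟨AbelianSchemeOver.serreTensor ρ E' hE', hrel, Db, polB, hTB, lvl', hsB, hDb⟩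
  have hℚ : (algebraMap Fi ℂ).comp (algebraMap ℚ Fi) = algebraMap ℚ ℂ := Subsingleton.elim _ _
  let xℚ : specOver ℚ ℂ ⟶ Xℚ := Over.homMk Pt.left (by
    change Pt.left ≫ X.hom ≫ bcSpec ℚ Fi = (specOver ℚ ℂ).hom
    rw [← Category.assoc, Over.w Pt]
    change Spec.map (CommRingCat.ofHom (algebraMap Fi ℂ)) ≫ Spec.map (CommRingCat.ofHom (algebraMap ℚ Fi)) =
      Spec.map (CommRingCat.ofHom (algebraMap ℚ ℂ))
    rw [← Spec.map_comp, ← CommRingCat.ofHom_comp, hℚ])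
  -- DEAL #38: the fibre of `T_𝔞` at `Pt` is admissible at `(C.Z a′ v, r′·ũ_V(1,t))`, hence `φ` sends `Pt` to the Siegel point of that class
  have key := SiegelFineModuliScheme.pts_comp_classifyingMap_eq_mk_of_isAdmissibleAt C.hδ C.𝓜 C.Sc C.ιc C.unif C.u C.rep C.pts
    C.rep_spec C.pts_unif C.junction C.hg C.hN C.isColimit_ιc.some C.unif_surj T𝔞 xℚ (T𝔞.baseChange xℚ.left)
    (T𝔞.baseChange_isBaseChangeVia xℚ.left)
    (isAdmissibleAt_baseChange_of_admPackage C.hδ T𝔞 xℚ.left (hZ := C.Z_mem a' v hv) mB Θ₂ Λ₂ hample₂ hΘ₂ htower₂)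
  rw [hcls] at key
  -- the point map `f₂` has the same shadow there, and `pts ∘ bce` is injective
  have heq : xℚ ≫ C.𝓜.classifyingMap Xℚ T𝔞 = f₂ (ShimuraSetGS.mk F Jstar ι₁ Kc.1.1 v hv a') :=
    (AlgPoints.baseChangeEquiv (algebraMap ℚ ℂ) C.𝓜.M).injective (C.pts.injective (key.trans (hf₂ v hv a').symm))
  -- `ε₂` reads `φ` on first projections
  rw [hpts, ← heq]
  change (Pt ≫ ε₂).left ≫ pullback.fst C.𝓜.M.hom (bcSpec ℚ Fi) = (xℚ ≫ C.𝓜.classifyingMap Xℚ T𝔞).left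
  rw [Over.comp_left, Over.comp_left, Category.assoc, hε₂]
  rfl

end Summit.HodgeConjecture.HodgeConjecture.Theorems.F0P6aOrganB2SiegelAdmissible

end
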